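import Mathlib.Analysis.InnerProductSpace.l2Space
import Mathlib.Analysis.Calculus.ContDiff.Basic
import Mathlib.RepresentationTheory.Basic
import Mathlib.Topology.Algebra.InfiniteSum.Basic
import HarnessLib

/-!
# Tensor RG maps à la Kennedy–Rychkov: infinite-index four-leg tensors, torus partition
# functions, and the interface `TensorRGMap`

Topic `MathematicalPhysics/StatisticalMechanics`; namespace
`Literature.MathematicalPhysics.StatisticalMechanics`. Definition request `defn-TensorRGMap` of
route CriticalPhenomena/CardyTensorRG (crux stmt-CriticalPhenomena-7079 `CriticalTensorRGMap`):
the **interface** of a Kennedy–Rychkov-type tensor renormalisation-group map — the object whose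
EXISTENCE on a neighbourhood of the critical six-vertex/percolation orbit is that crux. Nothing
here asserts existence; the structure only bundles data and the axioms the route's statements
consume.

Setting (Kennedy–Rychkov, *Tensor RG approach to high-temperature fixed point*, J. Stat. Phys.
(2022) = arXiv:2107.11464, §1–2: "Our tensors will be defined in an infinite-dimensional real
Hilbert space `V` with a countable basis … Each index will run from `0` to `∞`. For tensors with
any number of indices we will use the Hilbert–Schmidt norm … `‖A‖ = (∑ A_{ijkl}²)^{1/2}` …
Finiteness of Hilbert–Schmidt norm is equivalent to the tensor defining a continuous linear
mapping from `V ⊗ V ⊗ V ⊗ V` to `ℝ` with `V = ℓ₂(ℤ_{≥0})`"; "Our RG maps will preserve the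
partition function exactly"; "we will normalize the tensor at the end of each RG step, dividing it
by a scalar"; Ebel–Kennedy–Rychkov 2025, arXiv:2506.03247, §2, the graphical language of `2 × 2`
blockings with disentanglers and rotations):

* `FourTensor` — the real Hilbert space `ℓ²(ℕ × ℕ × ℕ × ℕ)` of four-leg tensors with finite
  Hilbert–Schmidt norm (Mathlib `lp _ 2`, an `InnerProductSpace ℝ` and `CompleteSpace`). A
  **weight** `w : ℕ → ℝ` (`1 ≤ w`) turns it into the weighted Hilbert–Schmidt space of the request
  by the dictionary "the element `B ∈ ℓ²` represents the tensor `A_{ijkl} = B_{ijkl} /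
  √(w i · w j · w k · w l)`", so that `‖B‖_{ℓ²} = ‖A‖_w`; accordingly the partition functions below
  carry a factor `(w e)⁻¹` for every bond `e` (`= ∏` over the two tensor legs meeting at `e` of
  `1/√w`). Legs are ordered (left, right, down, up).
* `cycSucc`, `cycPred` — cyclic successor/predecessor on `Fin n` (no `NeZero` needed);
  `TorusEdge n = (Fin n × Fin n) ⊕ (Fin n × Fin n)` — the horizontal bond to the right of, resp.
  the vertical bond above, each site of the `n × n` torus;
  `torusTerm w n T e`, `torusPartition w n T = ∑' e, torusTerm w n T e` — the **partition function
  of the `n × n` torus network** of the tensor represented by `T` (sum over bond indices of the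
  product over sites of the tensor entries; an unconditional `tsum`, absolutely convergent for
  Hilbert–Schmidt tensors on tori of side `≥ 2` by the generalised Hölder inequality for closed
  networks without self-contracted legs — not proved here; where not summable `tsum` is `0`. The
  `1 × 1` torus is a double self-trace, which Hilbert–Schmidt finiteness does not control —
  KR 2022, §2: "For some other operations, such as taking traces … finiteness of Hilbert–Schmidt
  norm may not be enough" — and is therefore excluded from the covariance axiom).
* `TensorRGMap w ρ` — the INTERFACE: for a weight `w` and a linear action `ρ` of a symmetry group
  `G` on `FourTensor` (in the application `G = U(1) × ℤ₂ × D₄`: arrow number, arrow reversal, leg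
  permutations/reflections of the square, KR 2022 Rem. on reflections; EKR 2025 §2), a structure
  with fields: an open `domain ⊆ FourTensor`; the map `map : FourTensor → FourTensor` (meaningful on
  `domain`); a positive scalar `normalization` (KR's `𝒩`, "dividing it by a scalar", tracked
  separately); the **covariance axiom** — for every `n ≥ 2` and `T ∈ domain`, the partition
  function of the `2n × 2n` torus of `T` equals `normalization T ^ (n * n)` times that of the
  `n × n` torus of `map T` (one coarse tensor per `2 × 2` block; KR 2022 §1 "Our RG maps will
  preserve the partition function exactly", EKR 2025 §2); `ρ`-invariance of the domain and
  **equivariance** of `map`; and **`C¹` regularity** `ContDiffOn ℝ 1 map domain`.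
* API: `torusTerm_zero` / `torusPartition_zero`, `TensorRGMap.empty` (the axioms are consistent:
  the structure with empty domain), `TensorRGMap.map_mem_of_mem`-type bookkeeping.

Not here: the boundary/corner extension (three-leg boundary and two-leg corner tensors,
open-rectangle networks) asked for by the same request for `BoundaryTwistTensors` — a separate
structure on top of this one; any construction (type 0/I/II steps, disentanglers `J : V ≃ V ⊗ V`);
the six-vertex tensor; summability of torus networks.

## References

* T. Kennedy, S. Rychkov, *Tensor RG approach to high-temperature fixed point*, J. Stat. Phys. 187
  (2022), arXiv:2107.11464, §1 (pp. 2–3), §2 (p. 4: Hilbert–Schmidt tensors, normalisation).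
  [KennedyRychkov2022]
* T. Kennedy, S. Rychkov, *Tensor renormalization group at low temperatures: discontinuity fixed
  point*, Ann. Henri Poincaré (2023). [KennedyRychkov2023]
* N. Ebel, T. Kennedy, S. Rychkov, arXiv:2506.03247 (2025), §2 (graphical language, rotations,
  disentanglers). [EbelKennedyRychkov2025]
-/

noncomputable section

open scoped BigOperators

namespace Literature.MathematicalPhysics.StatisticalMechanics

/-! ### Cyclic neighbours on `Fin n` -/

/-- Cyclic successor on `Fin n`: `i ↦ i + 1 (mod n)` (well defined as soon as `Fin n` is
inhabited, no `NeZero n` instance needed). [folklore] -/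
def cycSucc {n : ℕ} (i : Fin n) : Fin n := ⟨(i.1 + 1) % n, Nat.mod_lt _ i.pos⟩

/-- Cyclic predecessor on `Fin n`: `i ↦ i - 1 (mod n)`. [folklore] -/
def cycPred {n : ℕ} (i : Fin n) : Fin n := ⟨(i.1 + (n - 1)) % n, Nat.mod_lt _ i.pos⟩

/-- `cycSucc i = i + 1` as a natural number when `i + 1 < n`. [folklore] -/
theorem val_cycSucc_of_lt {n : ℕ} (i : Fin n) (h : i.1 + 1 < n) : (cycSucc i).1 = i.1 + 1 :=
  Nat.mod_eq_of_lt h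

/-- The cyclic successor of the last element is `0`. [folklore] -/
theorem val_cycSucc_of_eq {n : ℕ} (i : Fin n) (h : i.1 + 1 = n) : (cycSucc i).1 = 0 := by
  simp [cycSucc, h]

/-! ### Infinite-index four-leg tensors -/

/-- Index set of a four-leg tensor with legs valued in `V = ℓ²(ℕ)` (KR 2022, §2: "Each index will
run from `0` to `∞`"), ordered (left, right, down, up). [cite: KennedyRychkov2022, §2 (p. 4)] -/
abbrev FourIndex : Type := ℕ × ℕ × ℕ × ℕ

/-- **Hilbert–Schmidt four-leg tensors**: the real Hilbert space `ℓ²(ℕ⁴)` of arrays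
`A_{ijkl}` with `∑ A_{ijkl}² < ∞` (KR 2022, §2: "we will use the Hilbert–Schmidt norm …
`‖A‖ = (∑_{i,j,k,l} A_{ijkl}²)^{1/2}` … equivalent to the tensor defining a continuous linear
mapping from `V ⊗ V ⊗ V ⊗ V` to `ℝ` with `V = ℓ₂(ℤ_{≥0})`"). Mathlib's `lp _ 2`, an inner product
space over `ℝ` and complete. With a weight `w` an element `B` represents the tensor
`B_{ijkl}/√(w i w j w k w l)` of the weighted Hilbert–Schmidt space (module docstring).
[cite: KennedyRychkov2022, §2 (p. 4), Hilbert–Schmidt norm] -/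
abbrev FourTensor : Type := lp (fun _ : FourIndex => ℝ) 2

/-! ### Torus networks and their partition functions -/

/-- The bonds of the `n × n` torus: `Sum.inl s` is the horizontal bond joining the site `s` to its
right neighbour, `Sum.inr s` the vertical bond joining `s` to the site above it (so every site has
the four bonds `inl (left neighbour)`, `inl s`, `inr (lower neighbour)`, `inr s`). [folklore] -/
abbrev TorusEdge (n : ℕ) : Type := (Fin n × Fin n) ⊕ (Fin n × Fin n)

/-- The weight of the `n × n` torus network of `T` at the bond configuration `e` (an assignment of
an index to every bond): the product over the sites `s = (i, j)` of the tensor entry with legs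
(left, right, down, up) `= (e (inl (i-1, j)), e (inl (i, j)), e (inr (i, j-1)), e (inr (i, j)))`,
times the weight factor `∏_bonds (w (e b))⁻¹` implementing the weighted Hilbert–Schmidt dictionary
(`= 1` for `w = 1`). [cite: KennedyRychkov2022, §1 (p. 2: partition function as a tensor network)] -/
def torusTerm (w : ℕ → ℝ) (n : ℕ) (T : FourTensor) (e : TorusEdge n → ℕ) : ℝ :=
  (∏ b : TorusEdge n, (w (e b))⁻¹) *
    ∏ s : Fin n × Fin n,
      (T : FourIndex → ℝ)
        (e (Sum.inl (cycPred s.1, s.2)), e (Sum.inl s), e (Sum.inr (s.1, cycPred s.2)),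
          e (Sum.inr s))

/-- **The partition function of the `n × n` torus network** of the tensor represented by `T`:
`Z_n(T) = ∑_{e : bonds → ℕ} torusTerm w n T e` (unconditional sum `tsum`; absolutely convergent
for Hilbert–Schmidt tensors when `n ≥ 2`, by the generalised Hölder inequality for closed networks
in which no tensor contracts two of its own legs — not proved here, and `tsum = 0` where the family
is not summable; for `n = 1` the network is a double self-trace, not controlled by the
Hilbert–Schmidt norm, KR 2022 §2). [cite: KennedyRychkov2022, §1–2 (partition function of the tensor network; traces not controlled by the HS norm)] -/
def torusPartition (w : ℕ → ℝ) (n : ℕ) (T : FourTensor) : ℝ :=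
  ∑' e : TorusEdge n → ℕ, torusTerm w n T e

/-- The torus weight of the zero tensor vanishes as soon as the torus has a site (`n ≠ 0`).
[folklore] -/
theorem torusTerm_zero (w : ℕ → ℝ) {n : ℕ} (hn : n ≠ 0) (e : TorusEdge n → ℕ) :
    torusTerm w n 0 e = 0 := by
  haveI : NeZero n := ⟨hn⟩
  have h : ∏ s : Fin n × Fin n,
      ((0 : FourTensor) : FourIndex → ℝ)
        (e (Sum.inl (cycPred s.1, s.2)), e (Sum.inl s), e (Sum.inr (s.1, cycPred s.2)),
          e (Sum.inr s)) = 0 :=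
    Finset.prod_eq_zero (Finset.mem_univ ((0 : Fin n), (0 : Fin n))) (by simp)
  rw [torusTerm, h, mul_zero]

/-- The partition function of the zero tensor vanishes (`n ≠ 0`). [folklore] -/
theorem torusPartition_zero (w : ℕ → ℝ) {n : ℕ} (hn : n ≠ 0) : torusPartition w n 0 = 0 := by
  simp [torusPartition, torusTerm_zero w hn]

/-- On the empty torus (`n = 0`) the weight is the empty product `1`. [folklore] -/
theorem torusTerm_zero_size (w : ℕ → ℝ) (T : FourTensor) (e : TorusEdge 0 → ℕ) :
    torusTerm w 0 T e = 1 := by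
  simp [torusTerm]

/-! ### The interface -/

/-- **A Kennedy–Rychkov-type tensor RG map (interface).** Parameters: a weight `w : ℕ → ℝ` for the
weighted Hilbert–Schmidt norm (an element `B` of `FourTensor = ℓ²(ℕ⁴)` represents the tensor
`B/√(w⊗w⊗w⊗w)`), and a linear action `ρ` of a symmetry group `G` on `FourTensor` (in the
application `U(1) × ℤ₂ × D₄`: arrow number, arrow reversal, leg permutations/reflections of the
square). Fields: (i) `one_le_weight`; (ii) an open `domain` and the map `map` (only its values on
`domain` matter); (iii) a scalar `normalization`, positive on the domain (KR 2022, §2: "we will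
normalize the tensor at the end of each RG step, dividing it by a scalar"); (iv) **covariance of
torus partition functions under `2 × 2` blocking**: for `n ≥ 2` and `T ∈ domain`,
`Z_{2n}(T) = normalization T ^ (n·n) · Z_n(map T)` (KR 2022, §1: "Our RG maps will preserve the
partition function exactly"; EKR 2025, §2) — the `1 × 1` coarse torus is excluded (a double
self-trace, see `torusPartition`); (v) `ρ`-invariance of the domain and **equivariance**
`map (ρ g T) = ρ g (map T)`; (vi) **`C¹` (Fréchet) regularity** of `map` on `domain`. This is an
INTERFACE (hypothesis structure): its inhabitation on a neighbourhood of a critical orbit is the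
open crux `CriticalTensorRGMap` (stmt-CriticalPhenomena-7079); `TensorRGMap.empty` shows the axioms
are consistent. The boundary/corner extension is not included. [cite: KennedyRychkov2022, §1–2 (partition-function-preserving RG map on Hilbert–Schmidt tensors, normalisation by a scalar); interface posited by route CardyTensorRG] -/
structure TensorRGMap (w : ℕ → ℝ) {G : Type*} [Group G] (ρ : Representation ℝ G FourTensor) where
  /-- The weights are at least `1`. -/
  one_le_weight : ∀ i, 1 ≤ w i
  /-- The domain `N` of the RG map. -/
  domain : Set FourTensor
  /-- The domain is open in the Hilbert–Schmidt (`= w`-weighted, by the dictionary) topology. -/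
  isOpen_domain : IsOpen domain
  /-- The RG map `𝓡` (a total function; only its restriction to `domain` is constrained). -/
  map : FourTensor → FourTensor
  /-- The scalar normalisation `𝒩(T)` divided out at the end of the RG step. -/
  normalization : FourTensor → ℝ
  /-- `𝒩(T) > 0` on the domain. -/
  normalization_pos : ∀ T ∈ domain, 0 < normalization T
  /-- Exact covariance of torus partition functions under `2 × 2` blocking:
  `Z_{2n}(T) = 𝒩(T)^{n²} · Z_n(𝓡 T)` for `n ≥ 2`. -/
  covariance : ∀ n : ℕ, 2 ≤ n → ∀ T ∈ domain,
    torusPartition w (2 * n) T = normalization T ^ (n * n) * torusPartition w n (map T)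
  /-- The domain is invariant under the symmetry action. -/
  mem_domain_of_mem : ∀ (g : G), ∀ T ∈ domain, ρ g T ∈ domain
  /-- The RG map commutes with the symmetry action on the domain. -/
  equivariant : ∀ (g : G), ∀ T ∈ domain, map (ρ g T) = ρ g (map T)
  /-- The normalisation is invariant under the symmetry action on the domain. -/
  normalization_invariant : ∀ (g : G), ∀ T ∈ domain, normalization (ρ g T) = normalization T
  /-- `𝓡` is continuously Fréchet-differentiable on the domain. -/
  contDiffOn : ContDiffOn ℝ 1 map domain

namespace TensorRGMap

variable {w : ℕ → ℝ} {G : Type*} [Group G] {ρ : Representation ℝ G FourTensor}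

/-- **Consistency of the axioms**: for any weight `≥ 1` and any action, the structure with EMPTY
domain (identity map, normalisation `1`) is a `TensorRGMap` — all axioms are then vacuous. The
content of the notion is entirely in the size of `domain` (the crux `CriticalTensorRGMap` asks for
a domain containing a neighbourhood of a critical orbit). [folklore] -/
def empty (hw : ∀ i, 1 ≤ w i) : TensorRGMap w ρ where
  one_le_weight := hw
  domain := ∅
  isOpen_domain := isOpen_empty
  map := id
  normalization := fun _ => 1
  normalization_pos := fun _ h => h.elim
  covariance := fun _ _ _ h => h.elim
  mem_domain_of_mem := fun _ _ h => h.elim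
  equivariant := fun _ _ h => h.elim
  normalization_invariant := fun _ _ h => h.elim
  contDiffOn := contDiff_id.contDiffOn

/-- The weights of a tensor RG map are positive. [folklore] -/
theorem weight_pos (R : TensorRGMap w ρ) (i : ℕ) : 0 < w i :=
  one_pos.trans_le (R.one_le_weight i)

/-- `𝓡` is continuous on the domain (from `C¹`). [folklore] -/
theorem continuousOn (R : TensorRGMap w ρ) : ContinuousOn R.map R.domain :=
  R.contDiffOn.continuousOn

/-- Covariance iterated once along the symmetry action: for `g ∈ G`, `n ≥ 2` and `T ∈ domain`,
`Z_{2n}(ρ g T) = 𝒩(T)^{n²} · Z_n(ρ g (𝓡 T))`. [folklore] -/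
theorem covariance_smul (R : TensorRGMap w ρ) (g : G) {n : ℕ} (hn : 2 ≤ n) {T : FourTensor}
    (hT : T ∈ R.domain) :
    torusPartition w (2 * n) (ρ g T) =
      R.normalization T ^ (n * n) * torusPartition w n (ρ g (R.map T)) := by
  rw [R.covariance n hn _ (R.mem_domain_of_mem g T hT), R.equivariant g T hT,
    R.normalization_invariant g T hT]

end TensorRGMap

end Literature.MathematicalPhysics.StatisticalMechanics

end
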